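import Mathlib
import HarnessLib
import Literature.Computability.AlgebraicComplexity.PatternExpressions
import Literature.Computability.AlgebraicComplexity.DiPatternExpressions
import Literature.Computability.AlgebraicComplexity.ValiantClasses
import Summits.ValiantsHypothesis.ValiantsHypothesis.Theorems.MonotoneRestorationOrbitCompressionQPCompressionFloors

/-!
# Route MonotoneRestoration — aside `OrbitCompressionQP` (stmt-ValiantsHypothesis-18332): bipartite
# expressions are one-sorted expressions of the same length; floors of the ONE-SORTED compression stub

The repair of line `expression_compression` proposed on the item (evidence `di_expression_compression.lean`,
`Theorems/…OrbitCompressionQPDiLine.lean`: `OrbitSupport.OrbitCompressionQP_of_diStubs`) replaces the bipartite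
graph algebra `PatternExpr ℂ k l` by the one-sorted algebra `DiPatternExpr ℂ k` (directed looped patterns, the
currency in which the qp-orbit ⇒ narrow-expression direction is a THEOREM, `OrbitSupport.di_orbitToNarrowExpression`);
its open stub 2′ (DI-COMPRESSION) concludes
`∃ c, ∀ n ≥ 1, ∃ k (e : DiPatternExpr ℂ k), n^k ≤ 2^{(log₂ n + c)^c} ∧ |e| ≤ 2^{(log₂ n + c)^c} ∧ e.close n = f n`.

* `exists_diExpr_of_patternExpr` — **two sorts into one**: every `e : PatternExpr F k l` has a one-sorted twin
  `e' : DiPatternExpr F (k + l)` of the SAME length with `e'.value n ℓ = e.value n (ℓ ∘ castAdd) (ℓ ∘ natAdd)`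
  (row label `a ↦ castAdd l a`, column label `b ↦ natAdd k b`); hence `close_diExpr_of_patternExpr`:
  `e'.close n = e.close n`;
* `diNarrowQPLength_of_narrowQPLength` — the conclusion of the registered `stub_narrowExpressionCompression`
  implies the conclusion of the one-sorted stub 2′, for every family;
* `diNarrowCompression_of_polylogDegree`, `diNarrowCompression_of_rowColSparse(_VP)` — the floors of
  `Theorems/…OrbitCompressionQPCompressionFloors.lean`, transferred: the one-sorted compression stub holds, with
  no idea needed, for matrix-symmetric families of polylogarithmic degree (VP-free) and for row/column-sparse
  matrix-symmetric families of quasi-polynomially bounded degree (degree from `IsVPFamily` in the `_VP` form).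

Helper file (`--supports stmt-ValiantsHypothesis-18332`); def-free (the twin is produced inside an existential
by structural induction); nothing here is a named fact; VP ≠ VNP is not moved.
-/

noncomputable section

open MvPolynomial

-- `Summit.ValiantsHypothesis.ValiantsHypothesis.…` is the tree's single-conjunct layout (Sub = Summit).
set_option linter.dupNamespace false

namespace Summit.ValiantsHypothesis.ValiantsHypothesis.Theorems

namespace CompressionFloors

open Literature.Computability.AlgebraicComplexity

/-! ### Two sorts into one -/

section TwoSortsIntoOne

variable {F : Type} [CommSemiring F] {k l : ℕ}

/-- A row label (cast into the first block) never equals a column label (shifted into the second block).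
[folklore] -/
theorem castAdd_ne_natAdd (a : Fin k) (b : Fin l) : (Fin.castAdd l a : Fin (k + l)) ≠ Fin.natAdd k b := by
  intro h
  have := congrArg Fin.val h
  rw [Fin.val_castAdd, Fin.val_natAdd] at this
  omega

/-- **Two sorts into one.**  Every labelled bipartite pattern expression with `k` row and `l` column labels has
a one-sorted twin with `k + l` labels, of the same length, whose value at `ℓ : Fin (k+l) → Fin n` is the value
of the original at the row assignment `ℓ ∘ castAdd l` and the column assignment `ℓ ∘ natAdd k`.
[cite: DawarPagoSeppelt2025, §5 and §7 (p. 45)] -/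
theorem exists_diExpr_of_patternExpr (n : ℕ) :
    ∀ e : PatternExpr F k l, ∃ e' : DiPatternExpr F (k + l), e'.length = e.length ∧
      ∀ ℓ : Fin (k + l) → Fin n,
        e'.value n ℓ = e.value n (ℓ ∘ Fin.castAdd l) (ℓ ∘ Fin.natAdd k) := by
  intro e
  induction e with
  | edge a b =>
    exact ⟨DiPatternExpr.edge (Fin.castAdd l a) (Fin.natAdd k b), rfl, fun ℓ => by simp⟩
  | const c => exact ⟨DiPatternExpr.const c, rfl, fun ℓ => by simp⟩
  | add e₁ e₂ ih₁ ih₂ =>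
    obtain ⟨e₁', h₁, hv₁⟩ := ih₁
    obtain ⟨e₂', h₂, hv₂⟩ := ih₂
    exact ⟨DiPatternExpr.add e₁' e₂', by simp [DiPatternExpr.length, PatternExpr.length, h₁, h₂],
      fun ℓ => by simp [hv₁, hv₂]⟩
  | mul e₁ e₂ ih₁ ih₂ =>
    obtain ⟨e₁', h₁, hv₁⟩ := ih₁
    obtain ⟨e₂', h₂, hv₂⟩ := ih₂
    exact ⟨DiPatternExpr.mul e₁' e₂', by simp [DiPatternExpr.length, PatternExpr.length, h₁, h₂],
      fun ℓ => by simp [hv₁, hv₂]⟩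
  | sumRow a e ih =>
    obtain ⟨e', h, hv⟩ := ih
    refine ⟨DiPatternExpr.sumLabel (Fin.castAdd l a) e', by simp [DiPatternExpr.length, PatternExpr.length, h],
      fun ℓ => ?_⟩
    simp only [DiPatternExpr.value_sumLabel, PatternExpr.value_sumRow, hv]
    refine Finset.sum_congr rfl fun v _ => ?_
    rw [Function.update_comp_eq_of_injective _ (Fin.castAdd_injective k l),
      Function.update_comp_eq_of_forall_ne _ _ fun b => (castAdd_ne_natAdd a b).symm]
  | sumCol b e ih =>
    obtain ⟨e', h, hv⟩ := ih
    refine ⟨DiPatternExpr.sumLabel (Fin.natAdd k b) e', by simp [DiPatternExpr.length, PatternExpr.length, h],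
      fun ℓ => ?_⟩
    simp only [DiPatternExpr.value_sumLabel, PatternExpr.value_sumCol, hv]
    refine Finset.sum_congr rfl fun v _ => ?_
    rw [Function.update_comp_eq_of_injective _ (Fin.natAdd_injective l k),
      Function.update_comp_eq_of_forall_ne _ _ fun a => castAdd_ne_natAdd a b]

/-- **The twin has the same closed polynomial**: summing over `ℓ : Fin (k+l) → Fin n` is summing over the pairs
`(ℓ ∘ castAdd, ℓ ∘ natAdd)`. [folklore] -/
theorem exists_diClose_eq_close (n : ℕ) (e : PatternExpr F k l) :
    ∃ e' : DiPatternExpr F (k + l), e'.length = e.length ∧ e'.close n = e.close n := by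
  obtain ⟨e', hlen, hv⟩ := exists_diExpr_of_patternExpr n e
  refine ⟨e', hlen, ?_⟩
  rw [DiPatternExpr.close, PatternExpr.close, ← Fintype.sum_prod_type']
  -- reindex along `(Fin (k+l) → Fin n) ≃ (Fin k → Fin n) × (Fin l → Fin n)`
  refine Fintype.sum_equiv ((finSumFinEquiv.symm.arrowCongr (Equiv.refl (Fin n))).trans
    (Equiv.sumArrowEquivProdArrow (Fin k) (Fin l) (Fin n))) _ _ fun ℓ => ?_
  rw [hv]
  congr 1

end TwoSortsIntoOne

/-! ### The registered conclusion implies the one-sorted conclusion -/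

/-- **Bipartite narrow expressions of quasi-polynomial length are one-sorted narrow expressions of
quasi-polynomial length**: the conclusion of the registered `stub_narrowExpressionCompression` implies the
conclusion of the one-sorted compression stub, for every family. [folklore] -/
theorem diNarrowQPLength_of_narrowQPLength (f : (n : ℕ) → MvPolynomial (Fin n × Fin n) ℂ)
    (h : ∃ c : ℕ, ∀ n : ℕ, 1 ≤ n → ∃ (k l : ℕ) (e : PatternExpr ℂ k l),
      n ^ (k + l) ≤ 2 ^ ((Nat.log 2 n + c) ^ c) ∧ e.length ≤ 2 ^ ((Nat.log 2 n + c) ^ c) ∧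
      e.close n = f n) :
    ∃ c : ℕ, ∀ n : ℕ, 1 ≤ n → ∃ (k : ℕ) (e : DiPatternExpr ℂ k),
      n ^ k ≤ 2 ^ ((Nat.log 2 n + c) ^ c) ∧ e.length ≤ 2 ^ ((Nat.log 2 n + c) ^ c) ∧
      e.close n = f n := by
  obtain ⟨c, hc⟩ := h
  refine ⟨c, fun n hn => ?_⟩
  obtain ⟨k, l, e, hkl, hlen, hclose⟩ := hc n hn
  obtain ⟨e', hlen', hclose'⟩ := exists_diClose_eq_close n e
  exact ⟨k + l, e', hkl, hlen'.le.trans hlen, hclose'.trans hclose⟩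

/-! ### Floors of the one-sorted compression stub -/

/-- **One-sorted FLOOR 1 — polylogarithmic degree (VP-free).** Every matrix-symmetric family of degree
`≤ (log₂ n + c)^c` satisfies the conclusion of the one-sorted compression stub. [folklore] -/
theorem diNarrowCompression_of_polylogDegree (f : (n : ℕ) → MvPolynomial (Fin n × Fin n) ℂ)
    (hsymm : ∀ (n : ℕ) (σ τ : Equiv.Perm (Fin n)),
      rename (fun p : Fin n × Fin n => (σ p.1, τ p.2)) (f n) = f n)
    (hdeg : ∃ c : ℕ, ∀ n : ℕ, (f n).totalDegree ≤ (Nat.log 2 n + c) ^ c) :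
    ∃ c : ℕ, ∀ n : ℕ, 1 ≤ n → ∃ (k : ℕ) (e : DiPatternExpr ℂ k),
      n ^ k ≤ 2 ^ ((Nat.log 2 n + c) ^ c) ∧ e.length ≤ 2 ^ ((Nat.log 2 n + c) ^ c) ∧
      e.close n = f n :=
  diNarrowQPLength_of_narrowQPLength f (narrowCompression_of_polylogDegree f hsymm hdeg)

/-- **One-sorted FLOOR 2 — row/column-sparse families of quasi-polynomially bounded degree.** [folklore] -/
theorem diNarrowCompression_of_rowColSparse (f : (n : ℕ) → MvPolynomial (Fin n × Fin n) ℂ)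
    (hsymm : ∀ (n : ℕ) (σ τ : Equiv.Perm (Fin n)),
      rename (fun p : Fin n × Fin n => (σ p.1, τ p.2)) (f n) = f n)
    (hdeg : ∃ c : ℕ, ∀ n : ℕ, (f n).totalDegree ≤ 2 ^ ((Nat.log 2 n + c) ^ c))
    (hsparse : ∃ c : ℕ, ∀ n : ℕ, ∀ D ∈ (f n).support,
      (D.support.image Prod.fst).card ≤ (Nat.log 2 n + c) ^ c ∧
      (D.support.image Prod.snd).card ≤ (Nat.log 2 n + c) ^ c) :
    ∃ c : ℕ, ∀ n : ℕ, 1 ≤ n → ∃ (k : ℕ) (e : DiPatternExpr ℂ k),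
      n ^ k ≤ 2 ^ ((Nat.log 2 n + c) ^ c) ∧ e.length ≤ 2 ^ ((Nat.log 2 n + c) ^ c) ∧
      e.close n = f n :=
  diNarrowQPLength_of_narrowQPLength f (narrowCompression_of_rowColSparse f hsymm hdeg hsparse)

/-- **One-sorted FLOOR 2 for `VP` families** (degree from the p-family half of `IsVPFamily`). [folklore] -/
theorem diNarrowCompression_of_rowColSparse_VP (f : (n : ℕ) → MvPolynomial (Fin n × Fin n) ℂ)
    (hsymm : ∀ (n : ℕ) (σ τ : Equiv.Perm (Fin n)),
      rename (fun p : Fin n × Fin n => (σ p.1, τ p.2)) (f n) = f n)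
    (hVP : IsVPFamily f)
    (hsparse : ∃ c : ℕ, ∀ n : ℕ, ∀ D ∈ (f n).support,
      (D.support.image Prod.fst).card ≤ (Nat.log 2 n + c) ^ c ∧
      (D.support.image Prod.snd).card ≤ (Nat.log 2 n + c) ^ c) :
    ∃ c : ℕ, ∀ n : ℕ, 1 ≤ n → ∃ (k : ℕ) (e : DiPatternExpr ℂ k),
      n ^ k ≤ 2 ^ ((Nat.log 2 n + c) ^ c) ∧ e.length ≤ 2 ^ ((Nat.log 2 n + c) ^ c) ∧
      e.close n = f n :=
  diNarrowQPLength_of_narrowQPLength f (narrowCompression_of_rowColSparse_VP f hsymm hVP hsparse)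

end CompressionFloors

end Summit.ValiantsHypothesis.ValiantsHypothesis.Theorems

end
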